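import Summits.Parity.BatemanHorn.Theorems.AlmostPrimeZerosLinearCappedRepulsionTilted

/-!
# The AP tilted majorant, III: from `n ≤ x` to the progression `m ≡ b (mod a)`, `m ≤ ax + b`
(crux stmt-Parity-11291, line `smooth-rough-lattice-acquisition`, class `linₐ`, lead c2)

Everything here is PROVED (theorems only): the elementary reindexing behind the lead's assembly
`stub_apTiltedAssembly`.  For integers `a ≥ 2`, `b` and `x ∈ ℕ` put `y = (ax + b)⁺`; then
(`stub_apTiltedReindex`, registered helper stub)

  `Σ_{0≤n≤x} z^{s((an+b)⁺)} = #{n ≤ x : an + b ≤ 0} + Σ_{0<m≤y, m≡b (a)} z^{s(m)} − Σ_{0<m≤y, m≡b (a), m<b} z^{s(m)}`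

(`s(m) = Σ_{p^v ∥ m} min(v,2)`, `s(0) = 0`; the map `n ↦ an + b` is a bijection from
`{n ≤ x : an + b > 0}` onto `{0 < m ≤ y : m ≡ b (a), m ≥ b}`), together with the sizes of the two
boundary terms: `#{n ≤ x : an + b ≤ 0} ≤ |b| + 1` and the last sum has at most `|b|` terms, each of
modulus `≤ R^{2|b|+2}` when `‖z‖ ≤ R`, `R ≥ 1` (`s(m) ≤ 2ω(m) ≤ 2m + 2`).
-/

noncomputable section

namespace Summit.Parity.BatemanHorn.Cruxes.SystemZeroRepulsion.NearFar

open scoped BigOperators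

/-- `s(0) = 0`, so the term of `n` with `an + b ≤ 0` is `z⁰ = 1`. -/
theorem cap_toNat_of_nonpos {w : ℤ} (hw : w ≤ 0) :
    ((w.toNat).factorization.sum fun _ v => min v 2) = 0 := by
  rw [Int.toNat_of_nonpos hw, Nat.factorization_zero, Finsupp.sum_zero_index]

/-- `s(m) ≤ 2m + 2` (crude: `s ≤ 2ω` and `ω(m) ≤ m + 1`). -/
theorem cap_le_two_mul_add_two (m : ℕ) : (m.factorization.sum fun _ v => min v 2) ≤ 2 * m + 2 := by
  have h1 := Literature.NumberTheory.LFunctions.SelbergDelangeCapped.capExp_le m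
  have h2 : ArithmeticFunction.cardDistinctFactors m ≤ m + 1 := by
    rw [ArithmeticFunction.cardDistinctFactors_apply, ← List.card_toFinset, Nat.toFinset_factors]
    calc m.primeFactors.card ≤ (Finset.range (m + 1)).card :=
          Finset.card_le_card fun p hp => Finset.mem_range.2 (Nat.lt_succ_of_le (Nat.le_of_mem_primeFactors hp))
      _ = m + 1 := Finset.card_range _
  omega

/-- **Reindexing to the progression** (registered helper stub `stub_apTiltedReindex`). -/
theorem stub_apTiltedReindex :
    ∀ (a b : ℤ) (x : ℕ) (z : ℂ), 2 ≤ a →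
      ∑ n ∈ Finset.range (x + 1), z ^ (((a * (n : ℤ) + b).toNat).factorization.sum fun _ v => min v 2) =
        ((((Finset.range (x + 1)).filter fun n : ℕ => a * (n : ℤ) + b ≤ 0).card : ℕ) : ℂ) +
        (∑ m ∈ (Finset.Ioc 0 (a * (x : ℤ) + b).toNat).filter
            (fun m : ℕ => ((m : ℤ) : ZMod a.toNat) = ((b : ℤ) : ZMod a.toNat)),
          z ^ (m.factorization.sum fun _ v => min v 2)) -
        ∑ m ∈ ((Finset.Ioc 0 (a * (x : ℤ) + b).toNat).filter
            (fun m : ℕ => ((m : ℤ) : ZMod a.toNat) = ((b : ℤ) : ZMod a.toNat))).filter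
            (fun m : ℕ => (m : ℤ) < b),
          z ^ (m.factorization.sum fun _ v => min v 2) := by
  intro a b x z ha
  set q : ℕ := a.toNat with hqdef
  have hqa : (q : ℤ) = a := Int.toNat_of_nonneg (by linarith)
  have ha0 : 0 < a := by linarith
  set cap : ℕ → ℕ := fun m => m.factorization.sum fun _ v => min v 2 with hcap
  set y : ℕ := (a * (x : ℤ) + b).toNat with hydef
  set P := Finset.range (x + 1) with hP
  set W := (Finset.Ioc 0 y).filter (fun m : ℕ => ((m : ℤ) : ZMod q) = ((b : ℤ) : ZMod q)) with hW
  -- split `P` by the sign of `an + b`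
  have hsplit := (Finset.sum_filter_add_sum_filter_not P (fun n : ℕ => a * (n : ℤ) + b ≤ 0)
    (fun n : ℕ => z ^ cap ((a * (n : ℤ) + b).toNat))).symm
  have hzero : ∑ n ∈ P.filter (fun n : ℕ => a * (n : ℤ) + b ≤ 0), z ^ cap ((a * (n : ℤ) + b).toNat) =
      (((P.filter fun n : ℕ => a * (n : ℤ) + b ≤ 0).card : ℕ) : ℂ) := by
    rw [Finset.card_eq_sum_ones, Nat.cast_sum, Nat.cast_one]
    refine Finset.sum_congr rfl fun n hn => ?_
    rw [Finset.mem_filter] at hn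
    rw [hcap]
    simp only
    rw [cap_toNat_of_nonpos hn.2, pow_zero]
  -- split `W` by `m ≥ b`
  have hWsplit := Finset.sum_filter_add_sum_filter_not W (fun m : ℕ => (m : ℤ) < b)
    (fun m : ℕ => z ^ cap m)
  -- the bijection `n ↦ an + b` from `{n ∈ P : an + b > 0}` onto `{m ∈ W : m ≥ b}`
  have hcast : ((a : ℤ) : ZMod q) = 0 := by rw [← hqa]; simp
  have hbij : ∑ n ∈ P.filter (fun n : ℕ => ¬ (a * (n : ℤ) + b ≤ 0)), z ^ cap ((a * (n : ℤ) + b).toNat) =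
      ∑ m ∈ W.filter (fun m : ℕ => ¬ ((m : ℤ) < b)), z ^ cap m := by
    refine Finset.sum_nbij' (fun n : ℕ => (a * (n : ℤ) + b).toNat)
      (fun m : ℕ => (((m : ℤ) - b) / a).toNat) ?_ ?_ ?_ ?_ ?_
    · intro n hn
      rw [Finset.mem_filter, hP, Finset.mem_range] at hn
      obtain ⟨hnx, hpos⟩ := hn
      push Not at hpos
      have hm : (((a * (n : ℤ) + b).toNat : ℕ) : ℤ) = a * n + b := Int.toNat_of_nonneg hpos.le
      rw [Finset.mem_filter, hW, Finset.mem_filter, Finset.mem_Ioc]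
      refine ⟨⟨⟨?_, ?_⟩, ?_⟩, ?_⟩
      · exact (Int.lt_toNat).2 (by simpa using hpos)
      · rw [hydef]
        exact Int.toNat_le_toNat (by nlinarith)
      · rw [hm]; push_cast; rw [hcast]; ring
      · rw [hm]; push Not; nlinarith
    · intro m hm
      rw [Finset.mem_filter, hW, Finset.mem_filter, Finset.mem_Ioc] at hm
      obtain ⟨⟨⟨hm0, hmy⟩, hcong⟩, hmb⟩ := hm
      push Not at hmb
      have hdvd : (a : ℤ) ∣ (m : ℤ) - b := by
        rw [← hqa, ← ZMod.intCast_eq_intCast_iff_dvd_sub]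
        exact hcong.symm
      obtain ⟨k, hk⟩ := hdvd
      have hk0 : 0 ≤ k := by nlinarith
      have hdiv : ((m : ℤ) - b) / a = k := by rw [hk, Int.mul_ediv_cancel_left _ ha0.ne']
      have hmy' : (m : ℤ) ≤ a * x + b := by
        have h1 : ((y : ℕ) : ℤ) = max (a * x + b) 0 := Int.toNat_eq_max _
        have h2 : (m : ℤ) ≤ y := by exact_mod_cast hmy
        have h3 : 0 < (m : ℤ) := by exact_mod_cast hm0
        rcases le_or_gt (a * (x : ℤ) + b) 0 with h | h
        · rw [max_eq_right h] at h1; omega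
        · rw [max_eq_left h.le] at h1; omega
      have hkx : k ≤ x := by nlinarith
      rw [Finset.mem_filter, hP, Finset.mem_range, hdiv, Int.toNat_of_nonneg hk0]
      refine ⟨by omega, ?_⟩
      push Not
      have h3 : (0 : ℤ) < m := by exact_mod_cast hm0
      linarith
    · intro n hn
      rw [Finset.mem_filter] at hn
      obtain ⟨-, hpos⟩ := hn
      push Not at hpos
      rw [Int.toNat_of_nonneg hpos.le, add_sub_cancel_right, Int.mul_ediv_cancel_left _ ha0.ne',
        Int.toNat_natCast]
    · intro m hm
      rw [Finset.mem_filter, hW, Finset.mem_filter, Finset.mem_Ioc] at hm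
      obtain ⟨⟨⟨hm0, -⟩, hcong⟩, hmb⟩ := hm
      push Not at hmb
      have hdvd : (a : ℤ) ∣ (m : ℤ) - b := by
        rw [← hqa, ← ZMod.intCast_eq_intCast_iff_dvd_sub]
        exact hcong.symm
      obtain ⟨k, hk⟩ := hdvd
      have hk0 : 0 ≤ k := by nlinarith
      rw [hk, Int.mul_ediv_cancel_left _ ha0.ne', Int.toNat_of_nonneg hk0]
      have : a * k + b = m := by linarith
      rw [this, Int.toNat_natCast]
    · intro n hn
      rfl
  rw [hsplit, hzero, hbij, ← hWsplit]
  ring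

/-- The number of `n ≤ x` with `an + b ≤ 0` is at most `|b| + 1` (`a ≥ 2`). -/
theorem card_filter_nonpos_le (a b : ℤ) (x : ℕ) (ha : 2 ≤ a) :
    ((Finset.range (x + 1)).filter fun n : ℕ => a * (n : ℤ) + b ≤ 0).card ≤ b.natAbs + 1 := by
  calc ((Finset.range (x + 1)).filter fun n : ℕ => a * (n : ℤ) + b ≤ 0).card
      ≤ (Finset.range (b.natAbs + 1)).card := by
        refine Finset.card_le_card fun n hn => ?_
        rw [Finset.mem_filter] at hn
        rw [Finset.mem_range]
        have h := hn.2
        have hb : -b ≤ (b.natAbs : ℤ) := by rw [Int.natCast_natAbs]; exact neg_le_abs b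
        have h2 : (2 : ℤ) * n ≤ a * n := mul_le_mul_of_nonneg_right ha (by positivity)
        by_contra hcon
        push Not at hcon
        have h3 : (b.natAbs : ℤ) + 1 ≤ n := by exact_mod_cast hcon
        linarith
    _ = b.natAbs + 1 := Finset.card_range _

/-- The boundary sum `Σ_{0<m≤y, m≡b, m<b} z^{s(m)}` has modulus `≤ |b| · R^{2|b|+2}` for `‖z‖ ≤ R`,
`R ≥ 1`. -/
theorem norm_boundary_sum_le {a b : ℤ} {y : ℕ} {z : ℂ} {R : ℝ} (hR : 1 ≤ R) (hzR : ‖z‖ ≤ R) :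
    ‖∑ m ∈ ((Finset.Ioc 0 y).filter
        (fun m : ℕ => ((m : ℤ) : ZMod a.toNat) = ((b : ℤ) : ZMod a.toNat))).filter
        (fun m : ℕ => (m : ℤ) < b), z ^ (m.factorization.sum fun _ v => min v 2)‖ ≤
      (b.natAbs : ℝ) * R ^ (2 * b.natAbs + 2) := by
  set S := ((Finset.Ioc 0 y).filter
        (fun m : ℕ => ((m : ℤ) : ZMod a.toNat) = ((b : ℤ) : ZMod a.toNat))).filter
        (fun m : ℕ => (m : ℤ) < b) with hS
  have hsub : S ⊆ Finset.range b.natAbs := by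
    intro m hm
    rw [hS, Finset.mem_filter] at hm
    rw [Finset.mem_range]
    have := hm.2
    omega
  have hterm : ∀ m ∈ S, ‖z ^ (m.factorization.sum fun _ v => min v 2)‖ ≤ R ^ (2 * b.natAbs + 2) := by
    intro m hm
    have hmb : m < b.natAbs := Finset.mem_range.1 (hsub hm)
    rw [norm_pow]
    calc ‖z‖ ^ (m.factorization.sum fun _ v => min v 2) ≤ R ^ (m.factorization.sum fun _ v => min v 2) :=
          pow_le_pow_left₀ (norm_nonneg _) hzR _
      _ ≤ R ^ (2 * b.natAbs + 2) :=
          pow_le_pow_right₀ hR ((cap_le_two_mul_add_two m).trans (by omega))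
  calc ‖∑ m ∈ S, z ^ (m.factorization.sum fun _ v => min v 2)‖
      ≤ ∑ m ∈ S, ‖z ^ (m.factorization.sum fun _ v => min v 2)‖ := norm_sum_le _ _
    _ ≤ ∑ m ∈ S, R ^ (2 * b.natAbs + 2) := Finset.sum_le_sum hterm
    _ = (S.card : ℝ) * R ^ (2 * b.natAbs + 2) := by rw [Finset.sum_const, nsmul_eq_mul]
    _ ≤ (b.natAbs : ℝ) * R ^ (2 * b.natAbs + 2) := by
        have h1 : (S.card : ℝ) ≤ b.natAbs := by
          have := Finset.card_le_card hsub
          rw [Finset.card_range] at this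
          exact_mod_cast this
        have h2 : (0 : ℝ) ≤ R ^ (2 * b.natAbs + 2) := by positivity
        exact mul_le_mul_of_nonneg_right h1 h2

/-! ### Small lemmas for the assembly `stub_apTiltedAssembly` (appended by the lead, 2026-08-17) -/

/-- `(log y)^{p} ≤ (log x)^{p}·e^{r log κ}` for `x ≤ y ≤ κx`, `log x ≥ 1`, `κ ≥ 1`, `−r ≤ p ≤ r`. -/
theorem log_rpow_le_of_le_mul {x y κ p r : ℝ} (hx0 : 0 < x) (hx : 1 ≤ Real.log x) (hxy : x ≤ y)
    (hyκ : y ≤ κ * x) (hκ : 1 ≤ κ) (hpr : p ≤ r) (hpr' : -r ≤ p) :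
    Real.log y ^ p ≤ Real.log x ^ p * Real.exp (r * Real.log κ) := by
  have hlx0 : 0 < Real.log x := by linarith
  have hlogxy : Real.log x ≤ Real.log y := Real.log_le_log hx0 hxy
  have hlκ : 0 ≤ Real.log κ := Real.log_nonneg hκ
  have hr0 : 0 ≤ r := by linarith
  have hexp1 : 1 ≤ Real.exp (r * Real.log κ) := Real.one_le_exp (by positivity)
  have hlxp : 0 ≤ Real.log x ^ p := Real.rpow_nonneg hlx0.le p
  rcases le_or_gt p 0 with hp | hp
  · -- negative exponent: `(log y)^p ≤ (log x)^p`
    have h1 : Real.log y ^ p ≤ Real.log x ^ p := Real.rpow_le_rpow_of_nonpos hlx0 hlogxy hp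
    calc Real.log y ^ p ≤ Real.log x ^ p := h1
      _ = Real.log x ^ p * 1 := (mul_one _).symm
      _ ≤ Real.log x ^ p * Real.exp (r * Real.log κ) := mul_le_mul_of_nonneg_left hexp1 hlxp
  · -- positive exponent: `log y ≤ log x + log κ = log x (1 + log κ/log x)`
    have hy0 : 0 < y := hx0.trans_le hxy
    have hlogy : Real.log y ≤ Real.log x + Real.log κ := by
      have := Real.log_le_log hy0 hyκ
      rwa [Real.log_mul (by linarith) hx0.ne', add_comm] at this
    set u : ℝ := Real.log κ / Real.log x with hu
    have hu0 : 0 ≤ u := div_nonneg hlκ hlx0.le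
    have huκ : u ≤ Real.log κ := div_le_self hlκ hx
    have hfac : Real.log x + Real.log κ = Real.log x * (1 + u) := by
      rw [hu]; field_simp
    have hly0 : 0 ≤ Real.log y := hlx0.le.trans hlogxy
    calc Real.log y ^ p ≤ (Real.log x + Real.log κ) ^ p := Real.rpow_le_rpow hly0 hlogy hp.le
      _ = Real.log x ^ p * (1 + u) ^ p := by rw [hfac, Real.mul_rpow hlx0.le (by linarith)]
      _ ≤ Real.log x ^ p * Real.exp (r * Real.log κ) := by
          refine mul_le_mul_of_nonneg_left ?_ hlxp
          calc (1 + u) ^ p ≤ (Real.exp u) ^ p :=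
                Real.rpow_le_rpow (by linarith) (by linarith [Real.add_one_le_exp u]) hp.le
            _ = Real.exp (u * p) := (Real.exp_mul u p).symm
            _ ≤ Real.exp (r * Real.log κ) := by
                rw [Real.exp_le_exp]
                calc u * p ≤ Real.log κ * r := mul_le_mul huκ hpr hp.le hlκ
                  _ = r * Real.log κ := mul_comm _ _

/-- `1 ≤ x (log x)^p` when `log log x = L ≥ 0`, `−r ≤ p`, `r ≤ L/2` (`x (log x)^p ≥ exp(e^L − L²/2) ≥ 1`). -/
theorem one_le_mul_log_rpow {x L r p : ℝ} (hx : 0 < x) (hlog : 0 < Real.log x)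
    (hL : L = Real.log (Real.log x)) (hL0 : 0 ≤ L) (hr : r ≤ L / 2) (hp : -r ≤ p) :
    1 ≤ x * Real.log x ^ p := by
  have h𝓛eq : Real.log x = Real.exp L := by rw [hL, Real.exp_log hlog]
  have hpow : Real.log x ^ p = Real.exp (L * p) := by rw [Real.rpow_def_of_pos hlog, hL]
  have h1 : L * p ≥ -(L * r) := by nlinarith
  have h2 : L * r ≤ L ^ 2 / 2 := by nlinarith
  have h3 : 1 + L ^ 2 / 2 ≤ Real.exp L := by
    have := Real.quadratic_le_exp_of_nonneg hL0
    linarith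
  calc (1 : ℝ) ≤ Real.exp (Real.log x + L * p) := Real.one_le_exp (by rw [h𝓛eq]; linarith)
    _ = x * Real.log x ^ p := by rw [Real.exp_add, Real.exp_log hx, hpow]

/-- Orthogonality, pointwise: `𝟙[m ≡ b] z^{s} = φ(q)⁻¹ Σ_χ χ(b̄) χ(m) z^{s}` for a unit `b mod q`. -/
theorem indicator_eq_sum_characters {q : ℕ} [NeZero q] {β : ZMod q} (hβ : IsUnit β) (m : ℕ) (w : ℂ) :
    (if ((m : ℤ) : ZMod q) = β then w else 0) =
      ((q.totient : ℂ))⁻¹ * ∑ χ : DirichletCharacter ℂ q, χ β⁻¹ * (χ (m : ZMod q) * w) := by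
  have horth := DirichletCharacter.sum_char_inv_mul_char_eq ℂ hβ (m : ZMod q)
  have hφ : (q.totient : ℂ) ≠ 0 := by exact_mod_cast (Nat.totient_pos.2 (NeZero.pos q)).ne'
  have hsum : ∑ χ : DirichletCharacter ℂ q, χ β⁻¹ * (χ (m : ZMod q) * w) =
      (∑ χ : DirichletCharacter ℂ q, χ β⁻¹ * χ (m : ZMod q)) * w := by
    rw [Finset.sum_mul]
    refine Finset.sum_congr rfl fun χ _ => by ring
  rw [hsum, horth, Int.cast_natCast]
  by_cases h : (m : ZMod q) = β
  · rw [if_pos h, if_pos h.symm]; field_simp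
  · rw [if_neg h, if_neg (Ne.symm h)]; simp

/-- Bookkeeping of the boundary terms: `n₀ + u + b₁ ≤ (2|b|+1)X + nχ·M`. -/
theorem boundary_bookkeeping {n0 u b1 B X nM : ℝ} (hX : 1 ≤ X) (h1 : n0 ≤ B + 1) (h2 : u ≤ nM)
    (h3 : b1 ≤ B * X) (hB : 0 ≤ B) : n0 + u + b1 ≤ (2 * B + 1) * X + nM := by
  have h4 : B + 1 ≤ (B + 1) * X := le_mul_of_one_le_right (by linarith) hX
  nlinarith

/-- `b` is a unit mod `a` when `(a, b) = 1`, `a ≥ 0`. -/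
theorem isUnit_intCast_zmod_of_isCoprime {a b : ℤ} (ha : 0 ≤ a) (hcop : IsCoprime a b) :
    IsUnit ((b : ℤ) : ZMod a.toNat) := by
  obtain ⟨u, v, huv⟩ := hcop
  obtain ⟨q, hq⟩ : ∃ q : ℕ, q = a.toNat := ⟨_, rfl⟩
  rw [← hq]
  have hqa : (q : ℤ) = a := by rw [hq]; exact Int.toNat_of_nonneg ha
  have hcast : ((a : ℤ) : ZMod q) = 0 := by rw [← hqa]; simp
  have h1 : ((u * a + v * b : ℤ) : ZMod q) = 1 := by rw [huv]; simp
  push_cast at h1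
  rw [hcast, mul_zero, zero_add] at h1
  exact IsUnit.of_mul_eq_one_right _ h1

/-- **The progression sum through the characters**: if every character sum is `≤ M` in modulus,
then `‖Σ_{0<m≤y, m≡β} z^{s(m)}‖ ≤ #{χ}·M` (orthogonality, `φ(q) ≥ 1`, `|χ(β̄)| ≤ 1`); registered
helper stub `stub_apProgressionSum` of the crux. -/
theorem stub_apProgressionSum :
    ∀ (q : ℕ) [NeZero q] (β : ZMod q), IsUnit β → ∀ (y : ℕ) (z : ℂ) (M : ℝ),
      (∀ χ : DirichletCharacter ℂ q,
        ‖∑ n ∈ Finset.Ioc 0 y, χ (n : ZMod q) * z ^ (n.factorization.sum fun _ v => min v 2)‖ ≤ M) →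
      ‖∑ m ∈ (Finset.Ioc 0 y).filter (fun m : ℕ => ((m : ℤ) : ZMod q) = β),
          z ^ (m.factorization.sum fun _ v => min v 2)‖ ≤
        (Fintype.card (DirichletCharacter ℂ q) : ℝ) * M := by
  intro q _ β hβ y z M hM
  have hφ1 : (1 : ℝ) ≤ (q.totient : ℝ) := by exact_mod_cast Nat.totient_pos.2 (NeZero.pos q)
  rw [Finset.sum_filter]
  have hrew : ∑ m ∈ Finset.Ioc 0 y,
      (if ((m : ℤ) : ZMod q) = β then z ^ (m.factorization.sum fun _ v => min v 2) else 0) =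
      ((q.totient : ℂ))⁻¹ * ∑ χ : DirichletCharacter ℂ q, χ β⁻¹ *
        ∑ m ∈ Finset.Ioc 0 y, χ (m : ZMod q) * z ^ (m.factorization.sum fun _ v => min v 2) := by
    rw [Finset.mul_sum]
    simp_rw [Finset.mul_sum]
    rw [Finset.sum_comm]
    refine Finset.sum_congr rfl fun m _ => ?_
    rw [indicator_eq_sum_characters hβ m _, Finset.mul_sum]
  rw [hrew, norm_mul, norm_inv, Complex.norm_natCast]
  calc (q.totient : ℝ)⁻¹ * ‖∑ χ : DirichletCharacter ℂ q, χ β⁻¹ *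
        ∑ m ∈ Finset.Ioc 0 y, χ (m : ZMod q) * z ^ (m.factorization.sum fun _ v => min v 2)‖
      ≤ 1 * ∑ _χ : DirichletCharacter ℂ q, M := by
        refine mul_le_mul (inv_le_one_of_one_le₀ hφ1) ((norm_sum_le _ _).trans
          (Finset.sum_le_sum fun χ _ => ?_)) (norm_nonneg _) zero_le_one
        rw [norm_mul]
        calc ‖χ β⁻¹‖ * ‖∑ m ∈ Finset.Ioc 0 y, χ (m : ZMod q) *
              z ^ (m.factorization.sum fun _ v => min v 2)‖ ≤ 1 * M :=
              mul_le_mul (DirichletCharacter.norm_le_one _ _) (hM χ) (norm_nonneg _) zero_le_one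
          _ = M := one_mul _
    _ = (Fintype.card (DirichletCharacter ℂ q) : ℝ) * M := by
        rw [one_mul, Finset.sum_const, nsmul_eq_mul, Finset.card_univ]

/-- Curried form of `stub_apProgressionSum`. -/
theorem norm_progression_sum_le {q : ℕ} [NeZero q] {β : ZMod q} (hβ : IsUnit β) (y : ℕ) (z : ℂ)
    {M : ℝ} (hM : ∀ χ : DirichletCharacter ℂ q,
      ‖∑ n ∈ Finset.Ioc 0 y, χ (n : ZMod q) * z ^ (n.factorization.sum fun _ v => min v 2)‖ ≤ M) :
    ‖∑ m ∈ (Finset.Ioc 0 y).filter (fun m : ℕ => ((m : ℤ) : ZMod q) = β),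
        z ^ (m.factorization.sum fun _ v => min v 2)‖ ≤
      (Fintype.card (DirichletCharacter ℂ q) : ℝ) * M :=
  stub_apProgressionSum q β hβ y z M hM

/-- Size conversion from `y` back to `x`:
`y (log y)^p e^{A₁ R'} ≤ κ·(x (log x)^p)·e^{(A₁ + log κ + B') R'}` when `x ≤ y ≤ κx`,
`(log y)^p ≤ (log x)^p e^{r log κ}`, `r ≤ R'`, `B' ≥ 0`. -/
theorem size_conversion {x y κ r R' A₁ B' p : ℝ} (hx : 0 ≤ x) (hyκ : y ≤ κ * x) (hκ : 1 ≤ κ)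
    (hlp : 0 ≤ Real.log x ^ p) (hlogy : Real.log y ^ p ≤ Real.log x ^ p * Real.exp (r * Real.log κ))
    (hly : 0 ≤ Real.log y ^ p) (hr : r ≤ R') (hB' : 0 ≤ B') (hR' : 0 ≤ R') :
    y * Real.log y ^ p * Real.exp (A₁ * R') ≤
      κ * ((x * Real.log x ^ p) * Real.exp ((A₁ + Real.log κ + B') * R')) := by
  have hlκ : 0 ≤ Real.log κ := Real.log_nonneg hκ
  have e2 : Real.exp (r * Real.log κ) * Real.exp (A₁ * R') ≤
      Real.exp ((A₁ + Real.log κ + B') * R') := by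
    rw [← Real.exp_add, Real.exp_le_exp]
    have : r * Real.log κ ≤ R' * Real.log κ := mul_le_mul_of_nonneg_right hr hlκ
    nlinarith
  have hy : y ≤ κ * x := hyκ
  have hκ0 : 0 ≤ κ := by linarith
  calc y * Real.log y ^ p * Real.exp (A₁ * R')
      ≤ (κ * x) * (Real.log x ^ p * Real.exp (r * Real.log κ)) * Real.exp (A₁ * R') := by
        have h0 : 0 ≤ Real.exp (A₁ * R') := (Real.exp_pos _).le
        refine mul_le_mul_of_nonneg_right (mul_le_mul hy hlogy hly (by positivity)) h0
    _ = κ * ((x * Real.log x ^ p) * (Real.exp (r * Real.log κ) * Real.exp (A₁ * R'))) := by ring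
    _ ≤ κ * ((x * Real.log x ^ p) * Real.exp ((A₁ + Real.log κ + B') * R')) := by
        have h0 : 0 ≤ x * Real.log x ^ p := by positivity
        exact mul_le_mul_of_nonneg_left (mul_le_mul_of_nonneg_left e2 h0) hκ0


end Summit.Parity.BatemanHorn.Cruxes.SystemZeroRepulsion.NearFar

end
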